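import Literature.Probability.RandomPlanarGeometry.LoewnerThrFlow
import HarnessLib

/-!
# The through-swallow image chain in capacity time: continuity and the Loewner equation at regular times

Topic `Probability/RandomPlanarGeometry`; theorems only (crux `stmt-CriticalPhenomena-0698`, stub
`stub_isLocal`, through-swallow image chain of the locality of SLE₆: G. F. Lawler (2005), §6.3
Thm. 6.13 with Prop. 4.41; Lawler–Schramm–Werner (2003), §5 (5.1)). With the through-swallow clock
`σ = thrClock W A`, its inverse `τ = thrClockInv W A β` (`LoewnerThrClock`, under the integrability of
the rate provided by `integrableOn_thrClockRate`), the driving function `U* ∘ τ = thrImageDriverC W A β`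
and the flow `q ↦ g̃_{τ q}(ζ) = thrImageFlowC W A β z q` (`LoewnerThrFlowDefs`), on a horizon `[0, β]`
on which the remaining hull is closed and takes finitely many values:

* `continuous_thrImageDriverC`, `continuousOn_thrImageFlowC` — continuity in capacity time
  (`continuousOn_thrImageDriver/thrImageFlow` of `LoewnerThrFlow` and `continuousOn_thrClockInv`);
* `thrClockInv_eq_of_le`, `thrImageDriverC_eq_of_le` — nested horizons agree up to `σ β'`;
* `im_thrImageFlow_sub_thrImageDriver_pos` — `g̃_t(ζ) − U*_t = E_{B_t}(g_t z − W_t) ∈ ℍ`;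
* **at a regular time** `s` (the remaining hull constant `= B` on a two-sided piece around `s`; all
  but finitely many times are regular, `LoewnerThrPieces`): `hasDerivAt_thrClock` (`σ' = d_s²`, the
  rate being the continuous alive rate of `B` near `s`), `hasDerivAt_thrClockInv` (`τ' = 1/d²`),
  `hasDerivAt_thrImageFlow` ((5.1) for the alive flow of `B`, `hasDerivAt_imageFlow'`) and, by the chain
  rule, **`hasDerivAt_thrImageFlowC_of_regular`**: `∂_q g̃_{τ q}(ζ) = 2/(g̃_{τ q}(ζ) − U*_{τ q})`.
-/

noncomputable section

open Set Filter Topology Function Complex Metric MeasureTheory intervalIntegral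
open UpperHalfPlane (upperHalfPlaneSet)
open scoped NNReal

namespace Literature.Probability.RandomPlanarGeometry

namespace Loewner

variable {W : ℝ≥0 → ℝ} {A : Set ℂ}

/-! ### Reading `[0, β]` in real time -/

omit A in
/-- `t ∈ [0, β] ⇒ t⁺ ≤ β`. [folklore] -/
theorem toNNReal_le_of_mem_Icc {β : ℝ≥0} {t : ℝ} (ht : t ∈ Icc (0 : ℝ) β) : t.toNNReal ≤ β := by
  rw [← NNReal.coe_le_coe, Real.coe_toNNReal _ ht.1]; exact ht.2

/-- **`g̃_t(ζ) − U*_t ∈ ℍ`** for `z ∈ ℍ ∖ A` alive at `t`, the remaining hull at `t` being closed: the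
slid point `g_t z − W_t` lies in `ℍ ∖ B_t` and `g̃_t(ζ) − U*_t = E_{B_t}(g_t z − W_t)`. [folklore] -/
theorem im_thrImageFlow_sub_thrImageDriver_pos (hW : Continuous W) (hA : IsStarHull A) {t : ℝ≥0}
    (hcl : IsClosed (remHull W A t)) {z : ℂ} (hzH : 0 < z.im) (hzA : z ∉ A)
    (hz : (t : WithTop ℝ≥0) < swallowingTime W z) :
    0 < (thrImageFlow W A t z - thrImageDriver W A t).im := by
  have hB : IsStarHull (remHull W A t) := isStarHull_remHull hW hA hcl
  have hBt : IsStarHull (thrSlidHull W A t) := isStarHull_thrSlidHull hW hA hcl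
  have hy : map W t z - W t ∈ upperHalfPlaneSet \ thrSlidHull W A t :=
    map_sub_driving_mem_diff_slidHull hW hB (disjoint_closedHull_remHull W A le_rfl) hzH
      (fun h ↦ hzA (remHull_subset W A t h)) hz
  rw [thrImageFlow_sub_thrImageDriver, starMap_eq hBt]
  exact hullExt_im_pos (Φ := starRMap _ hBt) hy

section Chain

variable (hW : Continuous W) (hW0 : W 0 = 0) (hA : IsStarHull A) {β : ℝ≥0}
  (hcl : ∀ t ≤ β, IsClosed (remHull W A t)) (hfin : (remHull W A '' Icc 0 β).Finite)

/-! ### Continuity in capacity time -/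

include hW hW0 hA hcl hfin in
/-- **`q ↦ U*_{τ q} = thrImageDriverC W A β q` is continuous** (`U*` is continuous on `[0, β]`, `τ` on
`[0, σβ]`, and the clamp `q ↦ q ∧ σβ` is continuous into `[0, σβ]`). [cite: Lawler2005, §6.3 Thm. 6.13 (U* continuous)] -/
theorem continuous_thrImageDriverC : Continuous (thrImageDriverC W A β) := by
  have hint := integrableOn_thrClockRate hW hA hcl hfin
  have hτ := continuousOn_thrClockInv hint
  have hWt : ContinuousOn (fun t : ℝ ↦ thrImageDriver W A t.toNNReal) (Icc (0 : ℝ) β) :=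
    (continuousOn_thrImageDriver hW hA hcl hfin hW0).comp continuous_real_toNNReal.continuousOn
      fun t ht ↦ toNNReal_le_of_mem_Icc ht
  have hcomp : ContinuousOn (fun q : ℝ ↦ thrImageDriver W A (thrClockInv W A β q).toNNReal)
      (Icc (0 : ℝ) (thrClock W A β)) :=
    hWt.comp hτ fun q hq ↦ (thrClockInv_spec hint hq).1
  have hclamp : Continuous fun q : ℝ≥0 ↦ min (q : ℝ) (thrClock W A β) :=
    NNReal.continuous_coe.min continuous_const
  have hS0 : 0 ≤ thrClock W A β := (thrClock_mem hint ⟨β.coe_nonneg, le_rfl⟩).1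
  exact hcomp.comp_continuous hclamp fun q ↦ ⟨le_min q.coe_nonneg hS0, min_le_right _ _⟩

variable {z : ℂ} (hzH : 0 < z.im) (hzA : z ∉ A) (hzβ : (β : WithTop ℝ≥0) < swallowingTime W z)

include hW hW0 hA hcl hfin hzH hzA hzβ in
/-- Continuity of `q ↦ g̃_{τ q}(ζ)` and of `q ↦ U*_{τ q}` within `[0, σβ]`. [folklore] -/
theorem continuousOn_thrImageFlowC :
    ContinuousOn (thrImageFlowC W A β z) (Icc (0 : ℝ) (thrClock W A β)) ∧
    ContinuousOn (fun q : ℝ ↦ (thrImageDriver W A (thrClockInv W A β q).toNNReal : ℂ))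
      (Icc (0 : ℝ) (thrClock W A β)) := by
  have hint := integrableOn_thrClockRate hW hA hcl hfin
  have hτ := continuousOn_thrClockInv hint
  have hG : ContinuousOn (fun t : ℝ ↦ thrImageFlow W A t.toNNReal z) (Icc (0 : ℝ) β) :=
    (continuousOn_thrImageFlow hW hA hcl hfin hzH hzA hzβ).comp continuous_real_toNNReal.continuousOn
      fun t ht ↦ toNNReal_le_of_mem_Icc ht
  have hWt : ContinuousOn (fun t : ℝ ↦ thrImageDriver W A t.toNNReal) (Icc (0 : ℝ) β) :=
    (continuousOn_thrImageDriver hW hA hcl hfin hW0).comp continuous_real_toNNReal.continuousOn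
      fun t ht ↦ toNNReal_le_of_mem_Icc ht
  refine ⟨hG.comp hτ fun q hq ↦ (thrClockInv_spec hint hq).1, ?_⟩
  exact Complex.continuous_ofReal.comp_continuousOn (hWt.comp hτ fun q hq ↦ (thrClockInv_spec hint hq).1)

include hW hA hcl hzH hzA hzβ in
/-- `g̃_{τ q}(ζ) − U*_{τ q} ∈ ℍ` for `q ∈ [0, σβ]`. [folklore] -/
theorem im_thrImageFlowC_sub_pos (hint : IntegrableOn (thrClockRate W A) (Icc (0 : ℝ) β))
    {q : ℝ} (hq : q ∈ Icc (0 : ℝ) (thrClock W A β)) :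
    0 < (thrImageFlowC W A β z q - thrImageDriver W A (thrClockInv W A β q).toNNReal).im := by
  have ht := (thrClockInv_spec hint hq).1
  have hle : (thrClockInv W A β q).toNNReal ≤ β := toNNReal_le_of_mem_Icc ht
  exact im_thrImageFlow_sub_thrImageDriver_pos hW hA (hcl _ hle) hzH hzA
    (lt_of_le_of_lt (WithTop.coe_le_coe.2 hle) hzβ)

/-! ### Nested horizons -/

include hW hA hcl hfin in
/-- **The inverse clocks of nested horizons agree on the smaller range.** [folklore] -/
theorem thrClockInv_eq_of_le {β' : ℝ≥0} (hβ'β : β' ≤ β) {q : ℝ} (hq : q ∈ Icc (0 : ℝ) (thrClock W A β')) :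
    thrClockInv W A β' q = thrClockInv W A β q := by
  have hint := integrableOn_thrClockRate hW hA hcl hfin
  have hint' : IntegrableOn (thrClockRate W A) (Icc (0 : ℝ) β') :=
    hint.mono_set (Icc_subset_Icc_right (NNReal.coe_le_coe.2 hβ'β))
  obtain ⟨ht', hσ'⟩ := thrClockInv_spec hint' hq
  have hmono := strictMonoOn_thrClock hint
  have hq' : q ∈ Icc (0 : ℝ) (thrClock W A β) :=
    ⟨hq.1, hq.2.trans (hmono.monotoneOn ⟨β'.coe_nonneg, NNReal.coe_le_coe.2 hβ'β⟩ ⟨β.coe_nonneg, le_rfl⟩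
      (NNReal.coe_le_coe.2 hβ'β))⟩
  obtain ⟨ht, hσ⟩ := thrClockInv_spec hint hq'
  exact hmono.injOn ⟨ht'.1, ht'.2.trans (NNReal.coe_le_coe.2 hβ'β)⟩ ht (hσ'.trans hσ.symm)

include hW hA hcl hfin in
/-- The through-swallow drivers of nested horizons agree in capacity times `≤ σ β'`. [folklore] -/
theorem thrImageDriverC_eq_of_le {β' : ℝ≥0} (hβ'β : β' ≤ β) {q : ℝ} (hq : q ∈ Icc (0 : ℝ) (thrClock W A β')) :
    thrImageDriverC W A β' q.toNNReal = thrImageDriverC W A β q.toNNReal := by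
  have hint := integrableOn_thrClockRate hW hA hcl hfin
  have hmono := strictMonoOn_thrClock hint
  have hq' : q ∈ Icc (0 : ℝ) (thrClock W A β) :=
    ⟨hq.1, hq.2.trans (hmono.monotoneOn ⟨β'.coe_nonneg, NNReal.coe_le_coe.2 hβ'β⟩ ⟨β.coe_nonneg, le_rfl⟩
      (NNReal.coe_le_coe.2 hβ'β))⟩
  rw [thrImageDriverC_toNNReal hq, thrImageDriverC_toNNReal hq', thrClockInv_eq_of_le hW hA hcl hfin hβ'β hq]

/-! ### The Loewner equation at regular times -/

/-- Data of a regular time `s`: the remaining hull is constant on `[s₀, s']`, `s₀ < s < s' ≤ β`; then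
every real time in `(s₀, s')` reads the fixed `*`-hull `B = remHull W A s⁺`, alive at `s'`.
[folklore] -/
theorem regular_aux (hW : Continuous W) (hA : IsStarHull A) {β : ℝ≥0}
    (hcl : ∀ t ≤ β, IsClosed (remHull W A t)) {s : ℝ} {s₀ s' : ℝ≥0} (hs₀ : (s₀ : ℝ) < s)
    (hss' : s < s') (hs'β : s' ≤ β) (hconst : ∀ r ∈ Icc s₀ s', remHull W A r = remHull W A s.toNNReal) :
    IsStarHull (remHull W A s.toNNReal) ∧ Disjoint (closedHull W s') (remHull W A s.toNNReal) ∧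
      0 < s ∧ s.toNNReal < s' ∧
      (∀ r ∈ Ioo (s₀ : ℝ) s', remHull W A r.toNNReal = remHull W A s.toNNReal) ∧
      Ioo (s₀ : ℝ) s' ∈ 𝓝 s := by
  have hs0 : 0 < s := lt_of_le_of_lt s₀.coe_nonneg hs₀
  have hsle : s.toNNReal < s' := by
    rw [← NNReal.coe_lt_coe, Real.coe_toNNReal _ hs0.le]; exact hss'
  have hmem : ∀ r ∈ Ioo (s₀ : ℝ) s', r.toNNReal ∈ Icc s₀ s' := fun r hr ↦ by
    have hr0 : 0 ≤ r := s₀.coe_nonneg.trans hr.1.le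
    constructor
    · rw [← NNReal.coe_le_coe, Real.coe_toNNReal _ hr0]; exact hr.1.le
    · rw [← NNReal.coe_le_coe, Real.coe_toNNReal _ hr0]; exact hr.2.le
  refine ⟨isStarHull_remHull hW hA (hcl _ (hsle.le.trans hs'β)), ?_, hs0, hsle,
    fun r hr ↦ hconst _ (hmem r hr), Ioo_mem_nhds hs₀ hss'⟩
  rw [← hconst s' ⟨?_, le_rfl⟩]
  · exact disjoint_closedHull_remHull W A le_rfl
  · exact ((hmem s ⟨hs₀, hss'⟩).1).trans hsle.le

include hW hA hcl hfin in
/-- **`HasDerivAt σ (d_s²) s` at a regular time `s`**: near `s` the rate is the continuous alive clock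
rate of the fixed remaining hull (`continuousWithinAt_starDeriv_slidHull'`), and `σ = ∫₀ rate`.
[cite: Lawler2005, Prop. 4.41] -/
theorem hasDerivAt_thrClock {s : ℝ} {s₀ s' : ℝ≥0} (hs₀ : (s₀ : ℝ) < s) (hss' : s < s') (hs'β : s' ≤ β)
    (hconst : ∀ r ∈ Icc s₀ s', remHull W A r = remHull W A s.toNNReal) :
    HasDerivAt (thrClock W A) (thrClockRate W A s) s := by
  have hint := integrableOn_thrClockRate hW hA hcl hfin
  obtain ⟨hB, hBal, hs0, hsle, heq, hnhds⟩ := regular_aux hW hA hcl hs₀ hss' hs'β hconst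
  set B := remHull W A s.toNNReal with hBdef
  have hsβ : s < β := hss'.trans_le (NNReal.coe_le_coe.2 hs'β)
  -- continuity of the rate at `s`
  have hcont : ContinuousAt (thrClockRate W A) s := by
    have h1 : ContinuousWithinAt (fun r : ℝ ↦ starDeriv (slidHull W B r.toNNReal)) (Icc (0 : ℝ) s') s :=
      continuousWithinAt_comp_toNNReal hBal s
        (continuousWithinAt_starDeriv_slidHull' hW hB (alive_mono hsle.le hBal))
    have h2 : ContinuousAt (fun r : ℝ ↦ starDeriv (slidHull W B r.toNNReal) ^ 2) s :=
      (h1.continuousAt (Icc_mem_nhds hs0 hss')).pow 2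
    refine h2.congr ?_
    filter_upwards [hnhds] with r hr
    exact (thrClockRate_eq_imageClockRate_remHull (heq r hr)).symm
  have hmeas : StronglyMeasurableAtFilter (thrClockRate W A) (𝓝 s) volume :=
    ⟨Icc (0 : ℝ) β, Icc_mem_nhds hs0 hsβ, hint.aestronglyMeasurable⟩
  exact integral_hasDerivAt_right (intervalIntegrable_thrClockRate hint ⟨le_rfl, β.coe_nonneg⟩ ⟨hs0.le, hsβ.le⟩)
    hmeas hcont

include hW hA hcl hfin in
/-- **`HasDerivAt τ (d_{τ q}²)⁻¹ q`** when `τ q` is a regular time (inverse function rule).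
[cite: Lawler2005, Remark 4.5] -/
theorem hasDerivAt_thrClockInv {q : ℝ} (hq : q ∈ Ioo (0 : ℝ) (thrClock W A β)) {s₀ s' : ℝ≥0}
    (hs₀ : (s₀ : ℝ) < thrClockInv W A β q) (hss' : thrClockInv W A β q < s') (hs'β : s' ≤ β)
    (hconst : ∀ r ∈ Icc s₀ s', remHull W A r = remHull W A (thrClockInv W A β q).toNNReal) :
    HasDerivAt (thrClockInv W A β) (thrClockRate W A (thrClockInv W A β q))⁻¹ q := by
  have hint := integrableOn_thrClockRate hW hA hcl hfin
  refine HasDerivAt.of_local_left_inverse ?_ (hasDerivAt_thrClock hW hA hcl hfin hs₀ hss' hs'β hconst)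
    (thrClockRate_pos_le_one W A _).1.ne' ?_
  · exact (continuousOn_thrClockInv hint).continuousAt (Icc_mem_nhds hq.1 hq.2)
  · filter_upwards [Icc_mem_nhds hq.1 hq.2] with y hy
    exact thrClock_thrClockInv hint hy

include hW hA hcl hzH hzA hzβ in
/-- **(5.1) for the through-swallow flow at a regular time `s ∈ (0, β)`**:
`∂_t g̃_t(ζ) = 2 d_t²/(g̃_t(ζ) − U*_t)` (the alive flow of the fixed remaining hull plus a constant,
`hasDerivAt_imageFlow'`). [cite: LawlerSchrammWerner2003Restriction, §5 (5.1); Lawler2005, §6.3 Thm. 6.13] -/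
theorem hasDerivAt_thrImageFlow {s : ℝ} {s₀ s' : ℝ≥0} (hs₀ : (s₀ : ℝ) < s) (hss' : s < s') (hs'β : s' ≤ β)
    (hconst : ∀ r ∈ Icc s₀ s', remHull W A r = remHull W A s.toNNReal) :
    HasDerivAt (fun t : ℝ ↦ thrImageFlow W A t.toNNReal z)
      (2 * (starDeriv (thrSlidHull W A s.toNNReal) : ℂ) ^ 2 /
        (thrImageFlow W A s.toNNReal z - thrImageDriver W A s.toNNReal)) s := by
  obtain ⟨hB, hBal, hs0, hsle, heq, hnhds⟩ := regular_aux hW hA hcl hs₀ hss' hs'β hconst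
  set B := remHull W A s.toNNReal with hBdef
  have hzB : z ∉ B := fun h ↦ hzA (remHull_subset W A _ h)
  have hzs' : ((s' : ℝ≥0) : WithTop ℝ≥0) < swallowingTime W z :=
    lt_of_le_of_lt (WithTop.coe_le_coe.2 hs'β) hzβ
  have h := hasDerivAt_imageFlow' hW hB hBal hzH hzB hzs' hs0 hss'
  have h2 : HasDerivAt (fun t : ℝ ↦ imageFlow W B t.toNNReal z - starShift B + starShift A)
      (2 * (starDeriv (slidHull W B s.toNNReal) : ℂ) ^ 2 /
        (imageFlow W B s.toNNReal z - imageDriver W B s.toNNReal)) s :=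
    (h.sub_const _).add_const _
  have heqf : (fun t : ℝ ↦ thrImageFlow W A t.toNNReal z) =ᶠ[𝓝 s]
      fun t : ℝ ↦ imageFlow W B t.toNNReal z - starShift B + starShift A := by
    filter_upwards [hnhds] with r hr
    exact thrImageFlow_eq_of_remHull_eq (heq r hr) z
  have hval : 2 * (starDeriv (slidHull W B s.toNNReal) : ℂ) ^ 2 /
        (imageFlow W B s.toNNReal z - imageDriver W B s.toNNReal) =
      2 * (starDeriv (thrSlidHull W A s.toNNReal) : ℂ) ^ 2 /
        (thrImageFlow W A s.toNNReal z - thrImageDriver W A s.toNNReal) := by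
    rw [imageFlow_sub_imageDriver, thrImageFlow_sub_thrImageDriver, thrSlidHull]
  rw [← hval]
  exact h2.congr_of_eventuallyEq heqf

include hW hA hcl hfin hzH hzA hzβ in
/-- **`∂_q g̃_{τ q}(ζ) = 2/(g̃_{τ q}(ζ) − U*_{τ q})` at a capacity time `q ∈ (0, σβ)` whose original time
`τ q` is regular** (chain rule: (5.1) at `s = τ q` times `τ'(q) = (d_s²)⁻¹`).
[cite: LawlerSchrammWerner2003Restriction, §5 (5.1) after the time change; Lawler2005, Prop. 4.41] -/
theorem hasDerivAt_thrImageFlowC_of_regular {q : ℝ} (hq : q ∈ Ioo (0 : ℝ) (thrClock W A β))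
    {s₀ s' : ℝ≥0} (hs₀ : (s₀ : ℝ) < thrClockInv W A β q) (hss' : thrClockInv W A β q < s')
    (hs'β : s' ≤ β)
    (hconst : ∀ r ∈ Icc s₀ s', remHull W A r = remHull W A (thrClockInv W A β q).toNNReal) :
    HasDerivAt (thrImageFlowC W A β z)
      (2 / (thrImageFlowC W A β z q - thrImageDriver W A (thrClockInv W A β q).toNNReal)) q := by
  set s : ℝ := thrClockInv W A β q with hs
  have hτ' := hasDerivAt_thrClockInv hW hA hcl hfin hq hs₀ hss' hs'β hconst
  have hG := hasDerivAt_thrImageFlow hW hA hcl hzH hzA hzβ hs₀ hss' hs'β hconst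
  have h := hG.scomp q hτ'
  have hfun : (fun t : ℝ ↦ thrImageFlow W A t.toNNReal z) ∘ thrClockInv W A β = thrImageFlowC W A β z := rfl
  rw [hfun] at h
  refine h.congr_deriv ?_
  have hd : (starDeriv (thrSlidHull W A s.toNNReal) : ℂ) ≠ 0 :=
    ofReal_ne_zero.2 (starDeriv_pos_le_one _).1.ne'
  simp only [thrClockRate, thrImageFlowC, ← hs, Complex.real_smul]
  push_cast
  field_simp

end Chain

end Loewner

end Literature.Probability.RandomPlanarGeometry

end
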